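import Mathlib.Algebra.Homology.DerivedCategory.Ext.ExtClass
import HarnessLib

/-!
# The Yoneda duality pairing `Extʳ(M, C) × Extˢ(P, M) → Ext²(P, C) → Q` (Harari §16.2 (16.4) / §16.3, formal part)

Topic `Algebra/Homology`; namespace `Literature.Algebra.Homology.ExtDuality`.  Pure homological
algebra for Mathlib's `Abelian.Ext` in any abelian category with `HasExt`; no named fact, no `sorry`.

In Tate's duality theorem for class formations (Harari, *Galois Cohomology and Class Field Theory*,
§16.3, Thm. 16.21) the pairings `Ext^r_G(M, C) × H^{2−r}(G, M) → H²(G, C) ≅ ℚ/ℤ` are, once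
`H^q(G, ·)` is read as `Ext^q_{C_G}(ℤ, ·)` (the tree's comparison
`DiscreteRep.extTrivAddEquivContinuousCohomology`), nothing but YONEDA COMPOSITION followed by the
invariant map.  This file records that formal layer for an arbitrary abelian category `𝒞`, objects
`P` ("the point", `ℤ`) and `C` ("the formation module"), and an additive map
`inv : Ext²(P, C) →+ Q`:

* `pairing inv M h : Extʳ(M, C) →+ Extˢ(P, M) →+ Q` (`s + r = 2`), `⟨x, y⟩ = inv (y ∘ x)`;
* `pairing_mk₀_comp` — naturality in `M` (`⟨f^* x', y⟩ = ⟨x', f_* y⟩`);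
* `pairing_extClass_comp` — compatibility with the connecting homomorphisms of a short exact
  sequence in BOTH variables (`⟨δ x, y⟩ = ⟨x, δ y⟩`: the maps `α^r(G, M)` of §16.3 commute with the
  long exact sequences, the input of every five-lemma step in Lemma 16.19–Thm. 16.21) — by associativity
  of `Ext.comp`, with no sign;
* `adjointMap inv M h : Extʳ(M, C) →+ (Extˢ(P, M) →+ Q)` = Harari's `α^r(G, M)` and the predicates
  `AdjointInjective / AdjointSurjective / AdjointBijective`.

Written for Route A of the Poitou–Tate programme of crux `stmt-BirchSwinnertonDyer-19295` (cell
`bsd-schneider-ideate`, seat door-c4 gen 13), step G5′-iii vocabulary.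

## References
* D. Harari, *Galois Cohomology and Class Field Theory* (2020), §16.2 (the pairing (16.4) and its
  functoriality / compatibility with the long exact sequences, p. 272), §16.3 (the pairing
  `Ext^r_G(M, C) × H^{2−r}(G, M) → ℚ/ℤ` and the maps `α^r(G, M)`, pp. 274–275), Thm. 16.21. [Harari2020]
-/

-- CITATION-FIX (2026-08-27, door-c4 g13; referee flag Q-g51-1, held copy
-- `book:harari2017-galois-cohomology-class-field-theory`): §16.2/§16.3 loci corrected — the Yoneda
-- pairing `Ext^r_G(M,N) × Ext^s_G(P,M) → Ext^{r+s}_G(P,N)` and `Ext_{M,N}` are (16.4) in §16.2 (p. 272,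
-- "functorial in M and N … compatible with the long exact sequences"); the class-formation pairing and
-- the maps `α^r(G, M)` are §16.3 (pp. 274–275; §16.3 starts p. 274); "(16.5)" (inside the proof of
-- Prop. 16.18) and "Props. 16.13–16.16" (16.13 is a Remark, 16.14 a Theorem, 16.15 an Example) were
-- mis-attributions.  Declarations unchanged.

noncomputable section

universe w v u

namespace Literature.Algebra.Homology

namespace ExtDuality

open CategoryTheory CategoryTheory.Abelian

variable {𝒞 : Type u} [Category.{v} 𝒞] [Abelian 𝒞] [HasExt.{w} 𝒞]
  {P C : 𝒞} {Q : Type*} [AddCommGroup Q] (inv : Ext P C 2 →+ Q)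

/-- **The duality pairing `Extʳ(M, C) →+ Extˢ(P, M) →+ Q`, `⟨x, y⟩ = inv (y ∘ x)`** (`s + r = 2`).
[cite: Harari2020, §16.2 (16.4)] -/
def pairing (M : 𝒞) {r s : ℕ} (h : s + r = 2) : Ext M C r →+ Ext P M s →+ Q :=
  AddMonoidHom.mk' (fun x => inv.comp ((Ext.bilinearComp P M C s r 2 h).flip x))
    (fun x x' => by
      ext y
      simp only [AddMonoidHom.coe_comp, Function.comp_apply, AddMonoidHom.flip_apply,
        Ext.bilinearComp_apply_apply, AddMonoidHom.add_apply, map_add])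

/-- Formula: `⟨x, y⟩ = inv (y ∘ x)`. [cite: Harari2020, §16.2 (16.4)] -/
@[simp]
theorem pairing_apply (M : 𝒞) {r s : ℕ} (h : s + r = 2) (x : Ext M C r) (y : Ext P M s) :
    pairing inv M h x y = inv (y.comp x h) := rfl

/-- **Naturality in `M`**: `⟨f^* x', y⟩ = ⟨x', f_* y⟩` for `f : M ⟶ M'`.
[cite: Harari2020, §16.2 (16.4)] -/
theorem pairing_mk₀_comp {M M' : 𝒞} (f : M ⟶ M') {r s : ℕ} (h : s + r = 2) (x' : Ext M' C r)
    (y : Ext P M s) :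
    pairing inv M h ((Ext.mk₀ f).comp x' (zero_add r)) y =
      pairing inv M' h x' (y.comp (Ext.mk₀ f) (add_zero s)) := by
  rw [pairing_apply, pairing_apply, ← Ext.comp_assoc_of_second_deg_zero]

/-- **Compatibility with connecting homomorphisms**: for a short exact `0 → X₁ → X₂ → X₃ → 0` with
class `[S] ∈ Ext¹(X₃, X₁)`, `⟨[S] ∘ x, y⟩ = ⟨x, y ∘ [S]⟩` (`x ∈ Extʳ(X₁, C)`, `y ∈ Extˢ(P, X₃)`,
`s + 1 + r = 2`): the maps `α` commute with the long exact sequences in both variables, with no sign.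
[cite: Harari2020, §16.2 (16.4)] -/
theorem pairing_extClass_comp {S : ShortComplex 𝒞} (hS : S.ShortExact) {r s r' s' : ℕ}
    (hr : 1 + r = r') (hs : s + 1 = s') (h : s + r' = 2) (h' : s' + r = 2) (x : Ext S.X₁ C r)
    (y : Ext P S.X₃ s) :
    pairing inv S.X₃ h (hS.extClass.comp x hr) y = pairing inv S.X₁ h' x (y.comp hS.extClass hs) := by
  rw [pairing_apply, pairing_apply, ← Ext.comp_assoc y hS.extClass x hs hr (by omega)]

/-- **Harari's `α^r(M)`: the adjoint map `Extʳ(M, C) →+ Hom(Extˢ(P, M), Q)`** of the pairing.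
[cite: Harari2020, §16.3] -/
abbrev adjointMap (M : 𝒞) {r s : ℕ} (h : s + r = 2) : Ext M C r →+ (Ext P M s →+ Q) :=
  pairing inv M h

/-- `α` is injective in the given bidegree. [cite: Harari2020, Theorem 16.21] -/
def AdjointInjective (M : 𝒞) {r s : ℕ} (h : s + r = 2) : Prop :=
  Function.Injective (adjointMap inv M h)

/-- `α` is surjective in the given bidegree. [cite: Harari2020, Theorem 16.21] -/
def AdjointSurjective (M : 𝒞) {r s : ℕ} (h : s + r = 2) : Prop :=
  Function.Surjective (adjointMap inv M h)

/-- `α` is bijective in the given bidegree (the conclusion of Tate's theorem 16.21 (a) for `r ≥ 2`).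
[cite: Harari2020, Theorem 16.21] -/
def AdjointBijective (M : 𝒞) {r s : ℕ} (h : s + r = 2) : Prop :=
  Function.Bijective (adjointMap inv M h)

/-- Naturality of `α` in `M`, adjoint form: `α(f^* x') = α(x') ∘ f_*`.
[cite: Harari2020, §16.3] -/
theorem adjointMap_mk₀_comp {M M' : 𝒞} (f : M ⟶ M') {r s : ℕ} (h : s + r = 2) (x' : Ext M' C r) :
    adjointMap inv M h ((Ext.mk₀ f).comp x' (zero_add r)) =
      (adjointMap inv M' h x').comp ((Ext.mk₀ f).postcomp P (add_zero s)) := by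
  ext y
  exact pairing_mk₀_comp inv f h x' y

/-- `α` commutes with the connecting maps: `α([S] ∘ x) = α(x) ∘ δ`.
[cite: Harari2020, §16.3] -/
theorem adjointMap_extClass_comp {S : ShortComplex 𝒞} (hS : S.ShortExact) {r s r' s' : ℕ}
    (hr : 1 + r = r') (hs : s + 1 = s') (h : s + r' = 2) (h' : s' + r = 2) (x : Ext S.X₁ C r) :
    adjointMap inv S.X₃ h (hS.extClass.comp x hr) =
      (adjointMap inv S.X₁ h' x).comp (hS.extClass.postcomp P hs) := by
  ext y
  exact pairing_extClass_comp inv hS hr hs h h' x y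

end ExtDuality

end Literature.Algebra.Homology
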